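import Mathlib
import Summits.ValiantsHypothesis.ValiantsHypothesis.Theorems.NewtonUnitEquationsDissociatedUniformTotalsLaw
import Summits.ValiantsHypothesis.ValiantsHypothesis.Theorems.NewtonUnitEquationsDissociatedUniformTotalsLawRankOne
import Literature.Computability.AlgebraicComplexity.NewtonPolygonTauProductBounds
import HarnessLib

/-!
# Crux `NewtonUnitEquations.DissociatedUniform` (stmt-ValiantsHypothesis-5905), `n = 3` totals law of model (Q**):
# the RANK-ONE stratum — THE REDUCTION `V_s ≤ ∑_{k ≤ 6} envPieces (instance k)` and its consequences

Companion of `…TotalsLawRankOne` (definitions: south-west exposed points `IsSWExposed`/`swCount`, the envelope problem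
`envPt`/`envPts`/`envPieces` with the located `@[conjecture] EnvelopeBound C`, the rank-one alphabets `rankOneA/B/C`, `rkPt`,
`rkFin`, the located `@[conjecture] RankOnePointwise C`, and the transport lemma `isStrictTop_image_of_compat`).  Memo
`Cruxes/DissociatedUniform/NOTES-t1g19.md`.

THIS FILE (all proved, arbitrary finite abelian `G`, ARBITRARY labellings `α β γ : G → ℝ`):
* the six sector maps `L₁ … L₆ : ℝ² → ℝ²` (injective) and the six (ENV) instances `inst₁ … inst₆` of a class `s`
  (`(∓α, ∓β, ∓γ(s-·))`, `(±β, ∓γ, ∓α(s-·))`, `(±α, ∓γ, ∓β(s-·))`), with `envPts (instₖ) = Lₖ (class s)` (`envPts_instₖ`; the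
  mixed instances re-index the cells by `(x,y) ↦ (y, z)` or `(x, z)`, `eYZ`, `eXZ`);
* the sector lemmas `sw_sector₁ … sw_sector₆` (+ the degenerate `sw_sector₀`): a strict top of a finite set `F` for a weight
  `(u, v)` in sector `k` (sectors cut out by the six directions `±(1,0), ±(0,1), ±(1,-1)` in which one rank-one alphabet is
  invisible) is south-west exposed in `Lₖ(F)`, at the parameter `τ ∈ [0,1]` given by the ratio of the two kinetic coefficients;
  `sw_cover`: every weight lies in a sector;
* **`classVert_rankOne_le`**: `V_s ≤ ∑_{k=1}^{6} envPieces (instₖ)` for every class of a rank-one configuration;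
* **`envelopeBound_imp_rankOnePointwise : EnvelopeBound C → RankOnePointwise (6C)`**, `totalVert_rankOne_le_of_pointwise`
  (`RankOnePointwise C → T ≤ C|G|²`) and **`totalVert_rankOne_le_of_envelopeBound`** (`EnvelopeBound C → T ≤ 6C|G|²`: the `n = 3`
  totals law on the rank-one stratum, conditionally on the one-parameter envelope bound).
Honest label: an unconditional REDUCTION; `EnvelopeBound`, `RankOnePointwise`, `TotalsLawThree` remain OPEN and are asserted
nowhere; VP ≠ VNP is not touched.
[folklore: exposure of hull vertices; affine transport of strict maximisers]
-/

set_option linter.dupNamespace false -- `ValiantsHypothesis.ValiantsHypothesis` (summit = problem) in every name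

open scoped BigOperators
open Matrix Finset

namespace Summit.ValiantsHypothesis.ValiantsHypothesis.Theorems.NewtonUnitEquationsDissociatedUniform

namespace TotalsLaw

open Literature.Computability.AlgebraicComplexity.KPTT.PlanarMinkowski

section Reduction

variable {G : Type*} [AddCommGroup G] [Fintype G]
variable (α β γ : G → ℝ) (s : G)

/-! ### Sector lemmas: a strict top for a weight in sector `k` is south-west exposed in instance `k` -/

variable {F : Finset (Fin 2 → ℝ)} {p : Fin 2 → ℝ} {u v : ℝ}

/-- Sector 1: `u, v ≥ 0`, `u + v > 0`. [folklore] -/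
theorem sw_sector₁ (hu : 0 ≤ u) (hv : 0 ≤ v) (huv : 0 < u + v) (h : IsStrictTop ![u, v] F p) :
    IsSWExposed (F.image L₁) (L₁ p) := by
  classical
  refine ⟨u / (u + v), div_nonneg hu huv.le, (div_le_one huv).2 (by linarith), ?_⟩
  refine isStrictTop_image_of_compat h L₁ huv fun q => ?_
  rw [vec2_dot, vec2_dot]
  simp only [L₁, cons_val_zero, cons_val_one]
  field_simp
  ring

/-- Sector 2: `u, v ≤ 0`, `u + v < 0`. [folklore] -/
theorem sw_sector₂ (hu : u ≤ 0) (hv : v ≤ 0) (huv : u + v < 0) (h : IsStrictTop ![u, v] F p) :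
    IsSWExposed (F.image L₂) (L₂ p) := by
  classical
  have hm : 0 < -(u + v) := by linarith
  refine ⟨-u / -(u + v), div_nonneg (by linarith) hm.le, (div_le_one hm).2 (by linarith), ?_⟩
  have hne : u + v ≠ 0 := by linarith
  refine isStrictTop_image_of_compat h L₂ hm fun q => ?_
  rw [vec2_dot, vec2_dot]
  simp only [L₂, cons_val_zero, cons_val_one]
  field_simp
  ring

/-- Sector 3: `u > 0 > v`, `u + v ≥ 0`. [folklore] -/
theorem sw_sector₃ (hu : 0 < u) (hv : v < 0) (huv : 0 ≤ u + v) (h : IsStrictTop ![u, v] F p) :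
    IsSWExposed (F.image L₃) (L₃ p) := by
  classical
  refine ⟨-v / u, div_nonneg (by linarith) hu.le, (div_le_one hu).2 (by linarith), ?_⟩
  refine isStrictTop_image_of_compat h L₃ hu fun q => ?_
  rw [vec2_dot, vec2_dot]
  simp only [L₃, cons_val_zero, cons_val_one]
  field_simp
  ring

/-- Sector 4: `u < 0 < v`, `u + v ≤ 0`. [folklore] -/
theorem sw_sector₄ (hu : u < 0) (hv : 0 < v) (huv : u + v ≤ 0) (h : IsStrictTop ![u, v] F p) :
    IsSWExposed (F.image L₄) (L₄ p) := by
  classical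
  have hm : 0 < -u := by linarith
  refine ⟨v / -u, div_nonneg hv.le hm.le, (div_le_one hm).2 (by linarith), ?_⟩
  have hne : u ≠ 0 := by linarith
  refine isStrictTop_image_of_compat h L₄ hm fun q => ?_
  rw [vec2_dot, vec2_dot]
  simp only [L₄, cons_val_zero, cons_val_one]
  field_simp
  ring

/-- Sector 5: `u < 0 < v`, `u + v ≥ 0`. [folklore] -/
theorem sw_sector₅ (hu : u < 0) (hv : 0 < v) (huv : 0 ≤ u + v) (h : IsStrictTop ![u, v] F p) :
    IsSWExposed (F.image L₅) (L₅ p) := by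
  classical
  refine ⟨-u / v, div_nonneg (by linarith) hv.le, (div_le_one hv).2 (by linarith), ?_⟩
  refine isStrictTop_image_of_compat h L₅ hv fun q => ?_
  rw [vec2_dot, vec2_dot]
  simp only [L₅, cons_val_zero, cons_val_one]
  field_simp
  ring

/-- Sector 6: `v < 0 < u`, `u + v ≤ 0`. [folklore] -/
theorem sw_sector₆ (hu : 0 < u) (hv : v < 0) (huv : u + v ≤ 0) (h : IsStrictTop ![u, v] F p) :
    IsSWExposed (F.image L₆) (L₆ p) := by
  classical
  have hm : 0 < -v := by linarith
  refine ⟨u / -v, div_nonneg hu.le hm.le, (div_le_one hm).2 (by linarith), ?_⟩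
  have hne : v ≠ 0 := by linarith
  refine isStrictTop_image_of_compat h L₆ hm fun q => ?_
  rw [vec2_dot, vec2_dot]
  simp only [L₆, cons_val_zero, cons_val_one]
  field_simp
  ring

/-- Degenerate weight `w = 0`: then `F = {p}` and `p` is exposed in instance 1 trivially. [folklore] -/
theorem sw_sector₀ (h : IsStrictTop ![(0 : ℝ), 0] F p) : IsSWExposed (F.image L₁) (L₁ p) := by
  classical
  refine ⟨0, le_refl _, zero_le_one, Finset.mem_image.2 ⟨p, h.1, rfl⟩, fun y hy hne => ?_⟩
  obtain ⟨q, hq, rfl⟩ := Finset.mem_image.1 hy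
  have hqp : q ≠ p := fun e => hne (by rw [e])
  have := h.2 q hq hqp
  rw [vec2_dot, vec2_dot] at this
  simp at this

/-- **Covering.**  Every strict top of `F` (for any weight) is south-west exposed in one of the six transported copies
`L₁ F, …, L₆ F`. [folklore] -/
theorem sw_cover {w : Fin 2 → ℝ} (h : IsStrictTop w F p) :
    IsSWExposed (F.image L₁) (L₁ p) ∨ IsSWExposed (F.image L₂) (L₂ p) ∨ IsSWExposed (F.image L₃) (L₃ p) ∨
      IsSWExposed (F.image L₄) (L₄ p) ∨ IsSWExposed (F.image L₅) (L₅ p) ∨ IsSWExposed (F.image L₆) (L₆ p) := by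
  have hw : w = ![w 0, w 1] := by ext i; fin_cases i <;> rfl
  rw [hw] at h
  set u := w 0
  set v := w 1
  rcases le_or_gt 0 u with hu | hu <;> rcases le_or_gt 0 v with hv | hv
  · -- `u ≥ 0`, `v ≥ 0`
    rcases (add_nonneg hu hv).eq_or_lt with h0 | hpos
    · have hu0 : u = 0 := by linarith
      have hv0 : v = 0 := by linarith
      rw [hu0, hv0] at h
      exact Or.inl (sw_sector₀ h)
    · exact Or.inl (sw_sector₁ hu hv hpos h)
  · -- `u ≥ 0 > v`
    rcases hu.eq_or_lt with h0 | hupos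
    · exact Or.inr (Or.inl (sw_sector₂ (by rw [← h0]) hv.le (by linarith) h))
    · rcases le_or_gt 0 (u + v) with hs | hs
      · exact Or.inr (Or.inr (Or.inl (sw_sector₃ hupos hv hs h)))
      · exact Or.inr (Or.inr (Or.inr (Or.inr (Or.inr (sw_sector₆ hupos hv hs.le h)))))
  · -- `u < 0 ≤ v`
    rcases hv.eq_or_lt with h0 | hvpos
    · exact Or.inr (Or.inl (sw_sector₂ hu.le (by rw [← h0]) (by linarith) h))
    · rcases le_or_gt (u + v) 0 with hs | hs
      · exact Or.inr (Or.inr (Or.inr (Or.inl (sw_sector₄ hu hvpos hs h))))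
      · exact Or.inr (Or.inr (Or.inr (Or.inr (Or.inl (sw_sector₅ hu hvpos hs.le h)))))
  · -- `u < 0`, `v < 0`
    exact Or.inr (Or.inl (sw_sector₂ hu.le hv.le (by linarith) h))

/-! ### The reduction `V_s ≤ ∑_{k ≤ 6} envPieces (instance k)` -/

/-- The points of `F` whose `L`-image is south-west exposed in `L(F)`. -/
noncomputable def swPre (L : (Fin 2 → ℝ) → (Fin 2 → ℝ)) (F : Finset (Fin 2 → ℝ)) : Finset (Fin 2 → ℝ) := by
  classical exact F.filter fun p => IsSWExposed (F.image L) (L p)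

/-- Membership in `swPre`. [folklore] -/
theorem mem_swPre {L : (Fin 2 → ℝ) → (Fin 2 → ℝ)} {F : Finset (Fin 2 → ℝ)} {p : Fin 2 → ℝ} :
    p ∈ swPre L F ↔ p ∈ F ∧ IsSWExposed (F.image L) (L p) := by
  classical
  unfold swPre
  rw [Finset.mem_filter]

/-- `#swPre L F ≤ swCount (L(F))` for injective `L`. [folklore] -/
theorem card_swPre_le (L : (Fin 2 → ℝ) → (Fin 2 → ℝ)) (hL : Function.Injective L) (F : Finset (Fin 2 → ℝ)) :
    (swPre L F).card ≤ swCount (F.image L) := by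
  classical
  unfold swCount
  rw [← Finset.card_image_of_injective (swPre L F) hL]
  refine Finset.card_le_card fun y hy => ?_
  obtain ⟨p, hp, rfl⟩ := Finset.mem_image.1 hy
  rw [mem_swPre] at hp
  rw [Finset.mem_filter]
  exact ⟨Finset.mem_image.2 ⟨p, hp.1, rfl⟩, hp.2⟩

/-- **THE REDUCTION.**  For rank-one alphabets `a x = (α x, 0)`, `b y = (0, β y)`, `c z = (γ z, γ z)` (any finite abelian
`G`, ANY labellings) and every class `s`:
`V_s ≤ ∑_{k=1}^{6} envPieces (instance k)`, the six (ENV) instances `(∓α, ∓β, ∓γ(s-·))`, `(±β, ∓γ, ∓α(s-·))`,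
`(±α, ∓γ, ∓β(s-·))`.  Proof: a hull vertex is a strict top for some weight (exposure), the weight lies in one of six
sectors, and in sector `k` the map `L_k` transports strict tops to south-west exposed points of instance `k`. [folklore] -/
theorem classVert_rankOne_le :
    classVert (rankOneA α) (rankOneB β) (rankOneC γ) s ≤
      envPieces₃ (inst₁ α β γ s) + envPieces₃ (inst₂ α β γ s) + envPieces₃ (inst₃ α β γ s) +
        envPieces₃ (inst₄ α β γ s) + envPieces₃ (inst₅ α β γ s) + envPieces₃ (inst₆ α β γ s) := by
  classical
  set F := rkFin α β γ s with hF
  have hsub : (convexHull ℝ (F : Set (Fin 2 → ℝ))).extremePoints ℝ ⊆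
      ↑(swPre L₁ F ∪ swPre L₂ F ∪ swPre L₃ F ∪ swPre L₄ F ∪ swPre L₅ F ∪ swPre L₆ F) := by
    intro p hp
    obtain ⟨w, hw⟩ := exists_isStrictTop_of_mem_extremePoints hp
    have hpF : p ∈ F := hw.1
    rw [Finset.mem_coe]
    rcases sw_cover hw with h | h | h | h | h | h
    · exact Finset.mem_union_left _ (Finset.mem_union_left _ (Finset.mem_union_left _
        (Finset.mem_union_left _ (Finset.mem_union_left _ (mem_swPre.2 ⟨hpF, h⟩)))))
    · exact Finset.mem_union_left _ (Finset.mem_union_left _ (Finset.mem_union_left _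
        (Finset.mem_union_left _ (Finset.mem_union_right _ (mem_swPre.2 ⟨hpF, h⟩)))))
    · exact Finset.mem_union_left _ (Finset.mem_union_left _ (Finset.mem_union_left _
        (Finset.mem_union_right _ (mem_swPre.2 ⟨hpF, h⟩))))
    · exact Finset.mem_union_left _ (Finset.mem_union_left _ (Finset.mem_union_right _ (mem_swPre.2 ⟨hpF, h⟩)))
    · exact Finset.mem_union_left _ (Finset.mem_union_right _ (mem_swPre.2 ⟨hpF, h⟩))
    · exact Finset.mem_union_right _ (mem_swPre.2 ⟨hpF, h⟩)
  have h1 : (swPre L₁ F).card ≤ envPieces₃ (inst₁ α β γ s) := by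
    unfold envPieces₃ envPieces; rw [envPts_inst₁]; exact card_swPre_le L₁ L₁_injective F
  have h2 : (swPre L₂ F).card ≤ envPieces₃ (inst₂ α β γ s) := by
    unfold envPieces₃ envPieces; rw [envPts_inst₂]; exact card_swPre_le L₂ L₂_injective F
  have h3 : (swPre L₃ F).card ≤ envPieces₃ (inst₃ α β γ s) := by
    unfold envPieces₃ envPieces; rw [envPts_inst₃]; exact card_swPre_le L₃ L₃_injective F
  have h4 : (swPre L₄ F).card ≤ envPieces₃ (inst₄ α β γ s) := by
    unfold envPieces₃ envPieces; rw [envPts_inst₄]; exact card_swPre_le L₄ L₄_injective F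
  have h5 : (swPre L₅ F).card ≤ envPieces₃ (inst₅ α β γ s) := by
    unfold envPieces₃ envPieces; rw [envPts_inst₅]; exact card_swPre_le L₅ L₅_injective F
  have h6 : (swPre L₆ F).card ≤ envPieces₃ (inst₆ α β γ s) := by
    unfold envPieces₃ envPieces; rw [envPts_inst₆]; exact card_swPre_le L₆ L₆_injective F
  unfold classVert
  rw [← coe_rkFin]
  calc ((convexHull ℝ (F : Set (Fin 2 → ℝ))).extremePoints ℝ).ncard
      ≤ (↑(swPre L₁ F ∪ swPre L₂ F ∪ swPre L₃ F ∪ swPre L₄ F ∪ swPre L₅ F ∪ swPre L₆ F) : Set (Fin 2 → ℝ)).ncard :=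
        Set.ncard_le_ncard hsub (Finset.finite_toSet _)
    _ = (swPre L₁ F ∪ swPre L₂ F ∪ swPre L₃ F ∪ swPre L₄ F ∪ swPre L₅ F ∪ swPre L₆ F).card := Set.ncard_coe_finset _
    _ ≤ (swPre L₁ F).card + (swPre L₂ F).card + (swPre L₃ F).card + (swPre L₄ F).card + (swPre L₅ F).card +
          (swPre L₆ F).card := by
        refine (Finset.card_union_le _ _).trans ?_
        refine Nat.add_le_add_right ((Finset.card_union_le _ _).trans ?_) _
        refine Nat.add_le_add_right ((Finset.card_union_le _ _).trans ?_) _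
        refine Nat.add_le_add_right ((Finset.card_union_le _ _).trans ?_) _
        exact Nat.add_le_add_right (Finset.card_union_le _ _) _
    _ ≤ _ := by gcongr

end Reduction

/-! ### Consequences: the envelope bound implies the pointwise rank-one law and the `n = 3` law on the stratum -/

/-- **`EnvelopeBound C → RankOnePointwise (6C)`.** -/
theorem envelopeBound_imp_rankOnePointwise {C : ℕ} (h : EnvelopeBound C) : RankOnePointwise (6 * C) := by
  intro G _ _ α β γ s
  classical
  have hk : ∀ I : (G → ℝ) × (G → ℝ) × (G → ℝ), envPieces₃ I ≤ C * Fintype.card G := fun I => h G I.1 I.2.1 I.2.2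
  calc classVert (rankOneA α) (rankOneB β) (rankOneC γ) s ≤ _ := classVert_rankOne_le α β γ s
    _ ≤ C * Fintype.card G + C * Fintype.card G + C * Fintype.card G + C * Fintype.card G + C * Fintype.card G +
          C * Fintype.card G := by
        gcongr <;> exact hk _
    _ = 6 * C * Fintype.card G := by ring

/-- A pointwise class bound sums to a totals bound: `RankOnePointwise C → T ≤ C|G|²` on the rank-one stratum. -/
theorem totalVert_rankOne_le_of_pointwise {C : ℕ} (h : RankOnePointwise C) {G : Type} [AddCommGroup G] [Fintype G]
    (α β γ : G → ℝ) : totalVert (rankOneA α) (rankOneB β) (rankOneC γ) ≤ C * Fintype.card G ^ 2 := by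
  unfold totalVert
  calc ∑ s, classVert (rankOneA α) (rankOneB β) (rankOneC γ) s ≤ ∑ _s : G, C * Fintype.card G :=
        Finset.sum_le_sum fun s _ => h G α β γ s
    _ = C * Fintype.card G ^ 2 := by rw [Finset.sum_const, Finset.card_univ, smul_eq_mul]; ring

/-- **The `n = 3` totals law on the rank-one stratum, conditionally on the envelope bound**:
`EnvelopeBound C → T(a, b, c) ≤ 6C·|G|²` for all rank-one alphabets with arbitrary labellings. -/
theorem totalVert_rankOne_le_of_envelopeBound {C : ℕ} (h : EnvelopeBound C) {G : Type} [AddCommGroup G] [Fintype G]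
    (α β γ : G → ℝ) : totalVert (rankOneA α) (rankOneB β) (rankOneC γ) ≤ 6 * C * Fintype.card G ^ 2 :=
  totalVert_rankOne_le_of_pointwise (envelopeBound_imp_rankOnePointwise h) α β γ

end TotalsLaw

end Summit.ValiantsHypothesis.ValiantsHypothesis.Theorems.NewtonUnitEquationsDissociatedUniform
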